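import Mathlib
import Literature.NumberTheory.EllipticCurves.ThreeIsogeny
import Literature.NumberTheory.EllipticCurves.MordellCurvePhiDescentHom
import Literature.NumberTheory.EllipticCurves.VariableChangePointsMap
import Summits.BirchSwinnertonDyer.BirchSwinnertonDyer.Theorems.Rank2ObservatoryThreeIsoDescentHom
import Summits.BirchSwinnertonDyer.BirchSwinnertonDyer.Theorems.Rank2ObservatoryThreeIsoKernelEhat

/-!
# Rank-2 observatory — KERNEL-3ISO B1: the `Ê`-side 3-descent map over `K ∋ √-3`

HONEST FRAMING: per-curve certified theorems and census instruments; no claim on BSD in rank ≥ 2.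

For a rational Vélu three-pair `h : IsVeluThreePair m s E Ê` (`Ê : Y² = X³ + m²X² - 18msX
- (27s² + 16m³s)`) the kernel of the dual isogeny `φ̂ : Ê → E` is *not* pointwise rational: its
descent map takes values in `K*/K*³` for any field `K ⊇ ℚ` containing `θ` with `θ² = -3`
(Cohen, GTM 239, §8.4.2–8.4.4 with `d = 1`, `d̂ = -3`; Cohen–Pazuki §2). Over such a `K` the
translate `x̂ = X + 4m²/3` puts `Ê` in the shape `Y² = x̂³ - 3(m x̂ + b̂)²`, `b̂ = (27s - 4m³)/9`,
i.e. `Ê ≅ E_{θm, θb̂}` is again a three-torsion model, so the tree's generic 3-descent map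
(`ThreeIsoDescent.exists_threeDescentHom`, any field) applies to it. This file is def-free:

* `rat_coords_eq_zero`, `rat_coords_eq`, `cube_rat_coords` — `1, θ` are `ℚ`-free in `K` and
  `(u + vθ)³ = (u³ - 9uv²) + (3u²v - 3v³)θ`;
* `isVeluThreePair_twist` — `(E_{θm,θb̂}, E'_{θm,θb̂})` is a Vélu three-pair over `K`;
* `twist_eq_variableChange` — `⟨1, -4m²/3, 0, 0⟩ • (Ê ⊗ K) = E_{θm,θb̂}`;
* `exists_iota` — the additive map `ι : Ê(ℚ) →+ E_{θm,θb̂}(K)`, `(X, Y) ↦ (X + 4m²/3, Y)`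
  (Mathlib `Affine.Point.map` ∘ the tree's `VariableChange.pointEquiv` ∘ `congrEquiv`);
* `exists_descentHom_Ehat` — **the `Ê`-side descent map** `κ' : Ê(ℚ) →+ Additive (K*/K*³)`
  with `κ'(X, Y) = [Y - θ(m x̂ + b̂)]` at every affine rational point (the exceptional branch
  of the generic map never fires at a rational point: `not_exceptional`);
* `ker_descentHom_Ehat_le_range` — **Kummer containment** `ker κ' ≤ φ(E(ℚ))`, from the θ-free
  inversion `some_mem_range_pointHom_of_cube` (B2) by writing the cube root as `u + vθ`
  (hypothesis `hK : ∀ γ : K, ∃ u v : ℚ, γ = u + vθ`, i.e. `K = ℚ(θ)`);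
* `descent_Ehat_mul_conj` — the norm condition `(Y - θc)(Y + θc) = x̂³`; `descent_Ehat_rescale`,
  `cubeClass_twentySeven_mul` — the integral form `[Y₂ - θ(m₁X₂ + s₁)]`, `(m₁, s₁) = (3m, 81s - 12m³)`,
  `(X₂, Y₂) = (9X + 12m², 27Y)`, in which the support law (B3) is applied.

`κ'` is the `κ'` of the index theorem `three_pow_mordellWeilRank_succ_le_of_zsmul`; its finite
image bound (support law in `ℤ[ζ₃]`) is the subject of the B3 file.

References: [Cohen2007NumberTheoryI] §8.4.2 (Prop. 8.4.4, Lemma 8.4.5), §8.4.4 (Def. 8.4.7,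
Prop. 8.4.8); [CohenPazuki2009] §2 (Prop. 2.2).
-/

set_option linter.dupNamespace false

noncomputable section

open scoped Classical

open WeierstrassCurve

namespace Summit.BirchSwinnertonDyer.BirchSwinnertonDyer.Rank2Observatory.ThreeIso

open Literature.NumberTheory.EllipticCurves Literature.NumberTheory.EllipticCurves.MordellDescent

variable {K : Type*} [Field K] [CharZero K]

/-! ### `1, θ` are `ℚ`-free; cubes in the coordinates `(1, θ)` -/

/-- `θ ≠ 0` when `θ² = -3`. [folklore] -/
theorem theta_ne_zero {θ : K} (hθ : θ ^ 2 = -3) : θ ≠ 0 := by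
  rintro rfl
  norm_num at hθ

/-- `u + vθ = 0` with `u, v ∈ ℚ` forces `u = v = 0` (`θ² = -3` is not a rational square).
[folklore] -/
theorem rat_coords_eq_zero {θ : K} (hθ : θ ^ 2 = -3) {u v : ℚ} (h : (u : K) + v * θ = 0) :
    u = 0 ∧ v = 0 := by
  by_cases hv : v = 0
  · subst hv
    simp only [Rat.cast_zero, zero_mul, add_zero, Rat.cast_eq_zero] at h
    exact ⟨h, rfl⟩
  · exfalso
    have hθ' : θ = ((-u / v : ℚ) : K) := by
      have hvK : (v : K) ≠ 0 := by exact_mod_cast hv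
      push_cast
      field_simp
      linear_combination h
    have h3 : ((-u / v) ^ 2 : ℚ) = -3 := by
      have := hθ
      rw [hθ'] at this
      exact_mod_cast this
    nlinarith [sq_nonneg (-u / v)]

/-- Equality of `(1, θ)`-coordinates: `u + vθ = u' + v'θ ⇒ u = u' ∧ v = v'`. [folklore] -/
theorem rat_coords_eq {θ : K} (hθ : θ ^ 2 = -3) {u v u' v' : ℚ}
    (h : (u : K) + v * θ = u' + v' * θ) : u = u' ∧ v = v' := by
  have h0 : ((u - u' : ℚ) : K) + ((v - v' : ℚ) : K) * θ = 0 := by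
    push_cast
    linear_combination h
  obtain ⟨h1, h2⟩ := rat_coords_eq_zero hθ h0
  exact ⟨sub_eq_zero.mp h1, sub_eq_zero.mp h2⟩

/-- `(u + vθ)³ = (u³ - 9uv²) + (3u²v - 3v³)θ` when `θ² = -3`.
[cite: Cohen2007NumberTheoryI, Lemma 8.4.5 (proof)] -/
theorem cube_rat_coords {θ : K} (hθ : θ ^ 2 = -3) (u v : ℚ) :
    ((u : K) + v * θ) ^ 3 =
      ((u ^ 3 - 9 * u * v ^ 2 : ℚ) : K) + ((3 * u ^ 2 * v - 3 * v ^ 3 : ℚ) : K) * θ := by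
  push_cast
  linear_combination (3 * (u : K) * (v : K) ^ 2 + (v : K) ^ 3 * θ) * hθ

/-! ### The twisted three-torsion model `E_{θm, θb̂}` over `K` -/

variable {m s : ℚ} {W W' : WeierstrassCurve ℚ}

/-- `4(θm)³ - 27(θb̂) = -81 s θ` for `b̂ = (27s - 4m³)/9`. [folklore] -/
theorem disc_twist {θ : K} (hθ : θ ^ 2 = -3) (m s : ℚ) :
    4 * (θ * (m : K)) ^ 3 - 27 * (θ * ((27 * (s : K) - 4 * (m : K) ^ 3) / 9)) =
      -81 * (s : K) * θ := by
  linear_combination (4 * (m : K) ^ 3 * θ) * hθ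

/-- `Δ(E_{θm, θb̂}) ≠ 0` for a rational Vélu pair (`s ≠ 0`, `4m³ ≠ 27s`). [folklore] -/
theorem Δ_twist_ne_zero (h : IsVeluThreePair m s W W') {θ : K} (hθ : θ ^ 2 = -3) :
    (threeTorsionModel (θ * (m : K)) (θ * ((27 * (s : K) - 4 * (m : K) ^ 3) / 9))).Δ ≠ 0 := by
  rw [Δ_threeTorsionModel, disc_twist hθ]
  have hθ0 := theta_ne_zero hθ
  have hs : (s : K) ≠ 0 := by exact_mod_cast h.s_ne
  have hb : (27 * (s : K) - 4 * (m : K) ^ 3) / 9 ≠ 0 := by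
    have hd : (4 * m ^ 3 - 27 * s : ℚ) ≠ 0 := h.disc_ne
    have : (27 * (s : K) - 4 * (m : K) ^ 3) ≠ 0 := by
      have h' : ((27 * s - 4 * m ^ 3 : ℚ) : K) ≠ 0 := by
        have : (27 * s - 4 * m ^ 3 : ℚ) ≠ 0 := by
          intro h0; apply hd; linarith
        exact_mod_cast this
      push_cast at h'
      exact h'
    exact div_ne_zero this (by norm_num)
  have h16 : (16 : K) ≠ 0 := by norm_num
  have h81 : (-81 : K) ≠ 0 := by norm_num
  exact mul_ne_zero (mul_ne_zero h16 (pow_ne_zero _ (mul_ne_zero hθ0 hb)))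
    (mul_ne_zero (mul_ne_zero h81 hs) hθ0)

/-- **`(E_{θm,θb̂}, E'_{θm,θb̂})` is a Vélu three-pair over `K`.**
[cite: Cohen2007NumberTheoryI, Prop. 8.4.2 with `(d, d̂) = (1, -3)`] -/
theorem isVeluThreePair_twist (h : IsVeluThreePair m s W W') {θ : K} (hθ : θ ^ 2 = -3) :
    IsVeluThreePair (θ * (m : K)) (θ * ((27 * (s : K) - 4 * (m : K) ^ 3) / 9))
      (threeTorsionModel (θ * (m : K)) (θ * ((27 * (s : K) - 4 * (m : K) ^ 3) / 9)))
      (threeIsogenyCodomain (θ * (m : K)) (θ * ((27 * (s : K) - 4 * (m : K) ^ 3) / 9))) :=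
  isVeluThreePair_threeTorsionModel (Δ_twist_ne_zero h hθ)

/-- **`Ê ≅ E_{θm,θb̂}` over `K` by the translation `x̂ = X + 4m²/3`:**
`⟨1, -4m²/3, 0, 0⟩ • (Ê ⊗ K) = E_{θm, θb̂}`. [cite: Cohen2007NumberTheoryI, Prop. 8.4.2] -/
theorem twist_eq_variableChange (h : IsVeluThreePair m s W W') {θ : K} (hθ : θ ^ 2 = -3) :
    (⟨1, -(4 * (m : K) ^ 2 / 3), 0, 0⟩ : VariableChange K) • (W'.baseChange K) =
      threeTorsionModel (θ * (m : K)) (θ * ((27 * (s : K) - 4 * (m : K) ^ 3) / 9)) := by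
  ext
  · simp [variableChange_a₁, baseChange, h.a₁'_eq, threeTorsionModel]
  · simp only [variableChange_a₂, baseChange, map_a₂, map_a₁, h.a₂'_eq, h.a₁'_eq,
      threeTorsionModel, inv_one, Units.val_one, eq_ratCast, Rat.cast_pow, map_zero]
    linear_combination (-(m : K) ^ 2) * hθ
  · simp [variableChange_a₃, baseChange, h.a₃'_eq, h.a₁'_eq, threeTorsionModel]
  · simp only [variableChange_a₄, baseChange, map_a₁, map_a₂, map_a₃, map_a₄, h.a₁'_eq,
      h.a₂'_eq, h.a₃'_eq, h.a₄'_eq, threeTorsionModel, inv_one, Units.val_one, eq_ratCast,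
      Rat.cast_pow, Rat.cast_mul, Rat.cast_neg, Rat.cast_ofNat, map_zero]
    linear_combination (-(2 * (m : K) * ((27 * (s : K) - 4 * (m : K) ^ 3) / 9))) * hθ
  · simp only [variableChange_a₆, baseChange, map_a₁, map_a₂, map_a₃, map_a₄, map_a₆, h.a₁'_eq,
      h.a₂'_eq, h.a₃'_eq, h.a₄'_eq, h.a₆'_eq, threeTorsionModel, inv_one, Units.val_one,
      eq_ratCast, Rat.cast_pow, Rat.cast_mul, Rat.cast_neg, Rat.cast_add, Rat.cast_ofNat,
      map_zero]
    linear_combination (-(((27 * (s : K) - 4 * (m : K) ^ 3) / 9) ^ 2)) * hθ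

/-! ### `ι : Ê(ℚ) →+ E_{θm,θb̂}(K)` and the `Ê`-side descent map -/

/-- **`ι : Ê(ℚ) →+ E_{θm,θb̂}(K)`, `(X, Y) ↦ (X + 4m²/3, Y)`** — extension of scalars `ℚ → K`
(Mathlib `Affine.Point.map`) followed by the translation `⟨1, -4m²/3, 0, 0⟩` (the tree's
`VariableChange.pointEquiv`, transported along `twist_eq_variableChange`). Value-specified, no
definition added. [cite: Cohen2007NumberTheoryI, Prop. 8.4.2] -/
theorem exists_iota (h : IsVeluThreePair m s W W') {θ : K} (hθ : θ ^ 2 = -3) :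
    ∃ ι : W'.toAffine.Point →+
        (threeTorsionModel (θ * (m : K)) (θ * ((27 * (s : K) - 4 * (m : K) ^ 3) / 9))).toAffine.Point,
      ∀ (X Y : ℚ) (hQ : W'.toAffine.Nonsingular X Y), ∃ x₁ y₁ h₁,
        ι (.some X Y hQ) = .some x₁ y₁ h₁ ∧ x₁ = (X : K) + 4 * (m : K) ^ 2 / 3 ∧ y₁ = (Y : K) := by
  refine ⟨((Affine.Point.congrEquiv (twist_eq_variableChange h hθ)).toAddMonoidHom.comp
      (VariableChange.pointEquiv (W'.baseChange K)
        (⟨1, -(4 * (m : K) ^ 2 / 3), 0, 0⟩ : VariableChange K)).toAddMonoidHom).comp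
      (Affine.Point.map (W' := W') (F := ℚ) (Algebra.ofId ℚ K)), fun X Y hQ => ?_⟩
  rw [AddMonoidHom.comp_apply, AddMonoidHom.comp_apply, AddEquiv.coe_toAddMonoidHom,
    AddEquiv.coe_toAddMonoidHom]
  erw [Affine.Point.map_some (W' := W') (F := ℚ) (f := Algebra.ofId ℚ K) hQ]
  rw [VariableChange.pointEquiv_some, Affine.Point.congrEquiv_some]
  refine ⟨_, _, _, rfl, ?_, ?_⟩
  · rw [VariableChange.toX_def]
    simp only [inv_one, Units.val_one, one_pow, one_mul, sub_neg_eq_add, eq_ratCast]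
  · rw [VariableChange.toY_def]
    simp only [inv_one, Units.val_one, one_pow, one_mul, zero_mul, sub_zero, eq_ratCast]

/-- **The `Ê`-side 3-descent map** (Cohen's `α̂`, Def. 8.4.7 for `Ê` with `d̂ = -3`): an additive
`κ' : Ê(ℚ) →+ K*/K*³` with `κ'(X, Y) = [Y - θ(m x̂ + b̂)]`, `x̂ = X + 4m²/3`, `b̂ = (27s - 4m³)/9`,
at EVERY affine rational point (`Y - θ(m x̂ + b̂) ≠ 0` there, `not_exceptional`). It is the
generic descent map of `E_{θm,θb̂}/K` pulled back along `ι`. Value-specified, no definition added.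
[cite: Cohen2007NumberTheoryI, Def. 8.4.7, Prop. 8.4.8 (1)] -/
theorem exists_descentHom_Ehat (h : IsVeluThreePair m s W W') {θ : K} (hθ : θ ^ 2 = -3) :
    ∃ κ' : W'.toAffine.Point →+ Additive (CubeUnits K),
      ∀ (X Y : ℚ) (hQ : W'.toAffine.Nonsingular X Y),
        κ' (.some X Y hQ) = Additive.ofMul (cubeClass
          ((Y : K) - θ * ((m : K) * ((X : K) + 4 * (m : K) ^ 2 / 3)
            + (27 * (s : K) - 4 * (m : K) ^ 3) / 9))) := by
  obtain ⟨ι, hι⟩ := exists_iota h hθ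
  obtain ⟨κ, hκ⟩ := ThreeIsoDescent.exists_threeDescentHom (isVeluThreePair_twist h hθ)
  refine ⟨κ.comp ι, fun X Y hQ => ?_⟩
  obtain ⟨x₁, y₁, h₁, hιQ, hx₁, hy₁⟩ := hι X Y hQ
  rw [AddMonoidHom.comp_apply, hιQ, hκ]
  have hne : ¬ y₁ = θ * (m : K) * x₁ + θ * ((27 * (s : K) - 4 * (m : K) ^ 3) / 9) := by
    intro hy
    rw [hx₁, hy₁] at hy
    have h0 : ((Y : ℚ) : K) + ((0 : ℚ) : K) * θ =
        ((0 : ℚ) : K) + ((m * (X + 4 * m ^ 2 / 3) + (27 * s - 4 * m ^ 3) / 9 : ℚ) : K) * θ := by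
      push_cast
      linear_combination hy
    obtain ⟨hY, hc⟩ := rat_coords_eq hθ h0
    exact not_exceptional h hQ ⟨hY, hc.symm⟩
  rw [if_neg hne, hx₁, hy₁]
  congr 2
  ring

/-- **Kummer containment on the `Ê`-side: `ker κ' ≤ φ(E(ℚ))`.** If `Y - θ(m x̂ + b̂) = γ³` with
`γ = u + vθ ∈ K = ℚ(θ)`, comparing `(1, θ)`-coordinates gives `u³ - 9uv² = Y` and
`3u²v - 3v³ = -(m x̂ + b̂)`, and then `(X, Y) = φ(u² - (v - 2m/3)², u(u² - (v - 2m/3)²))`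
(`some_mem_range_pointHom_of_cube`). Hypothesis `hK`: every element of `K` is `u + vθ` with
`u, v ∈ ℚ`. This is the `hκ'` input of `three_pow_mordellWeilRank_succ_le_of_zsmul`.
[cite: Cohen2007NumberTheoryI, Prop. 8.4.4 (2), Lemma 8.4.5, Prop. 8.4.8 (2)] -/
theorem ker_descentHom_Ehat_le_range (h : IsVeluThreePair m s W W') {θ : K} (hθ : θ ^ 2 = -3)
    (hK : ∀ γ : K, ∃ u v : ℚ, γ = u + v * θ)
    (κ' : W'.toAffine.Point →+ Additive (CubeUnits K))
    (hκ' : ∀ (X Y : ℚ) (hQ : W'.toAffine.Nonsingular X Y),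
      κ' (.some X Y hQ) = Additive.ofMul (cubeClass
        ((Y : K) - θ * ((m : K) * ((X : K) + 4 * (m : K) ^ 2 / 3)
          + (27 * (s : K) - 4 * (m : K) ^ 3) / 9)))) :
    κ'.ker ≤ h.pointHom.range := by
  intro P hP
  rcases P with _ | ⟨X, Y, hQ⟩
  · exact ⟨0, by rw [← Affine.Point.zero_def, map_zero]⟩
  · rw [AddMonoidHom.mem_ker, hκ'] at hP
    set c : ℚ := m * (X + 4 * m ^ 2 / 3) + (27 * s - 4 * m ^ 3) / 9 with hc
    have hδ : (Y : K) - θ * ((m : K) * ((X : K) + 4 * (m : K) ^ 2 / 3)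
        + (27 * (s : K) - 4 * (m : K) ^ 3) / 9) = (Y : K) + ((-c : ℚ) : K) * θ := by
      rw [hc]
      push_cast
      ring
    rw [hδ] at hP
    have hδ0 : (Y : K) + ((-c : ℚ) : K) * θ ≠ 0 := by
      intro h0
      obtain ⟨hY, hc0⟩ := rat_coords_eq_zero hθ h0
      exact not_exceptional h hQ ⟨hY, neg_eq_zero.mp hc0⟩
    have h1 : cubeClass ((Y : K) + ((-c : ℚ) : K) * θ) = 1 := Additive.ofMul.injective hP
    obtain ⟨γ, -, hγ⟩ := (cubeClass_eq_one_iff hδ0).mp h1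
    obtain ⟨u, v, rfl⟩ := hK γ
    rw [cube_rat_coords hθ] at hγ
    obtain ⟨hre, him⟩ := rat_coords_eq hθ hγ
    exact some_mem_range_pointHom_of_cube h hQ hre.symm (by rw [← him])

/-! ### The norm condition and the integral rescaling (inputs of the B3 support law) -/

/-- **Norm condition** `N_{K/ℚ}(κ'(Q))` is a cube: `(Y - θc)(Y + θc) = x̂³` with
`c = m x̂ + b̂`, `x̂ = X + 4m²/3` (the curve equation of `Ê` in Cohen's coordinates).
[cite: Cohen2007NumberTheoryI, Prop. 8.4.8 (3)] -/
theorem descent_Ehat_mul_conj (h : IsVeluThreePair m s W W') {θ : K} (hθ : θ ^ 2 = -3)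
    {X Y : ℚ} (hQ : W'.toAffine.Nonsingular X Y) :
    ((Y : K) - θ * ((m : K) * ((X : K) + 4 * (m : K) ^ 2 / 3)
        + (27 * (s : K) - 4 * (m : K) ^ 3) / 9)) *
      ((Y : K) + θ * ((m : K) * ((X : K) + 4 * (m : K) ^ 2 / 3)
        + (27 * (s : K) - 4 * (m : K) ^ 3) / 9)) =
      ((X : K) + 4 * (m : K) ^ 2 / 3) ^ 3 := by
  have hE : ((Y ^ 2 : ℚ) : K) =
      ((X ^ 3 + m ^ 2 * X ^ 2 - 18 * m * s * X - (27 * s ^ 2 + 16 * m ^ 3 * s) : ℚ) : K) :=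
    congrArg (fun q : ℚ => (q : K)) ((h.equation'_iff X Y).mp hQ.left)
  push_cast at hE
  linear_combination hE - ((m : K) * ((X : K) + 4 * (m : K) ^ 2 / 3)
    + (27 * (s : K) - 4 * (m : K) ^ 3) / 9) ^ 2 * hθ

/-- **Integral rescaling.** With `(X₂, Y₂) = (9X + 12m², 27Y)` and `(m₁, s₁) = (3m, 81s - 12m³)`
one has `27 · (Y - θ(m x̂ + b̂)) = Y₂ - θ(m₁X₂ + s₁)`, and `27 = 3³`; hence `κ'(Q)` is the class
of `Y₂ - θ(m₁X₂ + s₁)`, an element of `ℤ[θ]`-shape when `m, s, X₂, Y₂` are integral — the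
form in which the support law (B3) is applied. [cite: CohenPazuki2009, §2 (integral models)] -/
theorem descent_Ehat_rescale {θ : K} (m s X Y : ℚ) :
    (27 : K) * ((Y : K) - θ * ((m : K) * ((X : K) + 4 * (m : K) ^ 2 / 3)
        + (27 * (s : K) - 4 * (m : K) ^ 3) / 9)) =
      ((27 * Y : ℚ) : K) - θ * (((3 * m : ℚ) : K) * ((9 * X + 12 * m ^ 2 : ℚ) : K)
        + ((81 * s - 12 * m ^ 3 : ℚ) : K)) := by
  push_cast
  ring

/-- The rescaled value has the same cube class: `[27 δ] = [δ]`. [folklore] -/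
theorem cubeClass_twentySeven_mul (δ : K) : cubeClass ((27 : K) * δ) = cubeClass δ := by
  by_cases hδ : δ = 0
  · rw [hδ, mul_zero]
  · rw [show (27 : K) * δ = δ * 3 ^ 3 by ring,
      cubeClass_mul_pow_three hδ (by norm_num : (3 : K) ≠ 0)]

end Summit.BirchSwinnertonDyer.BirchSwinnertonDyer.Rank2Observatory.ThreeIso
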